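import Literature.Geometry.DiscreteGeometry.HarborthInduction
import Mathlib.Analysis.SpecialFunctions.Complex.Arg
import Mathlib.Analysis.SpecialFunctions.Complex.Log
import Mathlib.Analysis.SpecialFunctions.Trigonometric.Angle
import Mathlib.Algebra.Order.ToIntervalMod
import Mathlib.Data.Finset.Max
import HarnessLib

/-!
# Bond angles of unit-disc configurations: "Jeder Kreis wird von höchstens sechs anderen berührt"

Topic `Literature/Geometry/DiscreteGeometry`, second file of the proof of Harborth's upper bound
(H. Harborth, Elem. Math. **29** (1974) 14–15 [Harborth1974], (5)); sequel to
`HarborthInduction.lean` (configurations `P : Finset ℂ`, `Harborth.nbrs`, `Harborth.IsHard`).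
The only METRIC inputs of Harborth's proof are (p. 14) "Jeder Kreis wird von höchstens sechs
anderen berührt" and "Die Innenwinkel an den Eckpunkten vom Typ `j` sind nicht kleiner als
`(j - 1)π/3`", both of which come from: two discs touching a third one subtend an angle `≥ π/3` at
its centre. This file proves exactly that, in the form the boundary-tracing files consume:

* `Harborth.ccwAngle u w ∈ [0, 2π)` — the counter-clockwise angle from the direction of `u` to
  the direction of `w` (`toIcoMod` of `arg w - arg u`), with its `Real.Angle` bridge
  (`coe_ccwAngle`), additivity modulo `2π` (`ccwAngle_add_ccwAngle`), reversal
  (`ccwAngle_rev`), rotation (`ccwAngle_mul_exp`, `eq_mul_exp_ccwAngle`), positive scaling.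
* `Harborth.norm_sub_sq_eq` — law of cosines for unit vectors,
  `‖u - w‖² = 2 - 2 cos (ccwAngle u w)`; hence `Harborth.pi_div_three_le_ccwAngle`: unit vectors
  at distance `≥ 1` make a counter-clockwise angle in `[π/3, 5π/3]`.
* `Harborth.card_sub_one_mul_le` — points of an interval `[L, U]` pairwise `≥ δ` apart number at
  most `(U - L)/δ + 1`.
* For a hard configuration: two neighbours of `p` subtend `ccwAngle ∈ [π/3, 5π/3]`
  (`ccwAngle_nbrs`), **at most six neighbours** (`card_nbrs_le_six`, Harborth p. 14 /
  Heitmann–Radin p. 282), and the **boundary form** `card_nbrs_sub_one_mul_le_of_gap`: if no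
  neighbour of `p` other than `q` lies at counter-clockwise angle `< γ` from `q` (an empty angular
  gap of size `γ` after `q`), then `(deg p - 1) · π/3 ≤ 2π - γ` — which is Harborth's (2) read at a
  single boundary vertex ("interior angle `≥ (j-1)π/3`", the interior angle being `2π - γ`).
-/

noncomputable section

namespace Literature.Geometry.DiscreteGeometry

namespace Harborth

open Complex Set Finset
open scoped Real

/-! ## §1 The counter-clockwise angle between two directions -/

/-- The **counter-clockwise angle** from the direction of `u` to the direction of `w`, normalised
to `[0, 2π)`. [cite: Harborth1974, p. 14] -/
def ccwAngle (u w : ℂ) : ℝ := toIcoMod Real.two_pi_pos 0 (arg w - arg u)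

/-- `0 ≤ ccwAngle u w`. [cite: Harborth1974, p. 14] -/
theorem ccwAngle_nonneg (u w : ℂ) : 0 ≤ ccwAngle u w :=
  (toIcoMod_mem_Ico' (hp := Real.two_pi_pos) (arg w - arg u)).1

/-- `ccwAngle u w < 2π`. [cite: Harborth1974, p. 14] -/
theorem ccwAngle_lt_two_pi (u w : ℂ) : ccwAngle u w < 2 * π :=
  (toIcoMod_mem_Ico' (hp := Real.two_pi_pos) (arg w - arg u)).2

/-- As an angle, `ccwAngle u w = arg w - arg u`. [cite: Harborth1974, p. 14] -/
theorem coe_ccwAngle (u w : ℂ) :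
    ((ccwAngle u w : ℝ) : Real.Angle) = (arg w : Real.Angle) - (arg u : Real.Angle) := by
  rw [ccwAngle, Real.Angle.coe_toIcoMod, Real.Angle.coe_sub]

/-- Two reals in `[0, 2π)` (resp. the second in `[0, 2π)` and the first within `2π` of it) with the
same angle are equal: the representative in `[0, 2π)` is unique. [folklore] -/
private theorem eq_of_coe_angle_eq {a b : ℝ} (ha0 : 0 ≤ a) (ha1 : a < 2 * π) (hb0 : 0 ≤ b)
    (hb1 : b < 2 * π) (h : (a : Real.Angle) = b) : a = b := by
  obtain ⟨k, hk⟩ := Real.Angle.angle_eq_iff_two_pi_dvd_sub.1 h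
  have hπ := Real.pi_pos
  have hk0 : k = 0 := by
    have h1 : (k : ℝ) < 1 := by
      by_contra hcon; push Not at hcon; nlinarith
    have h2 : (-1 : ℝ) < k := by
      by_contra hcon; push Not at hcon; nlinarith
    have h1' : k < 1 := by exact_mod_cast h1
    have h2' : -1 < k := by exact_mod_cast h2
    omega
  rw [hk0] at hk; simp at hk; linarith

/-- **Uniqueness of the representative**: if `arg w - arg u ≡ φ (mod 2π)` with `φ ∈ [0, 2π)` then
`ccwAngle u w = φ`. [cite: Harborth1974, p. 14] -/
theorem ccwAngle_eq_of_coe_eq {u w : ℂ} {φ : ℝ} (h0 : 0 ≤ φ) (h1 : φ < 2 * π)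
    (h : (arg w : Real.Angle) - (arg u : Real.Angle) = φ) : ccwAngle u w = φ :=
  eq_of_coe_angle_eq (ccwAngle_nonneg u w) (ccwAngle_lt_two_pi u w) h0 h1
    ((coe_ccwAngle u w).trans h)

/-- `ccwAngle u u = 0`. [cite: Harborth1974, p. 14] -/
theorem ccwAngle_self (u : ℂ) : ccwAngle u u = 0 :=
  ccwAngle_eq_of_coe_eq le_rfl Real.two_pi_pos (by simp)

/-- For non-zero vectors, `ccwAngle u w = 0` iff they have the same direction (`arg`).
[cite: Harborth1974, p. 14] -/
theorem ccwAngle_eq_zero_iff {u w : ℂ} : ccwAngle u w = 0 ↔ arg u = arg w := by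
  constructor
  · intro h
    have hc := coe_ccwAngle u w
    rw [h] at hc
    have : (arg w : Real.Angle) = arg u := sub_eq_zero.1 (by rw [← hc, Real.Angle.coe_zero])
    exact (arg_coe_angle_eq_iff.1 this).symm
  · intro h
    exact ccwAngle_eq_of_coe_eq le_rfl Real.two_pi_pos (by rw [h]; simp)

/-- **Additivity**: `ccwAngle u v + ccwAngle v w` is `ccwAngle u w` or `ccwAngle u w + 2π`.
[cite: Harborth1974, p. 14] -/
theorem ccwAngle_add_ccwAngle (u v w : ℂ) :
    ccwAngle u v + ccwAngle v w = ccwAngle u w ∨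
      ccwAngle u v + ccwAngle v w = ccwAngle u w + 2 * π := by
  have hc : ((ccwAngle u v + ccwAngle v w : ℝ) : Real.Angle) = (ccwAngle u w : ℝ) := by
    rw [Real.Angle.coe_add, coe_ccwAngle, coe_ccwAngle, coe_ccwAngle]; abel
  obtain ⟨k, hk⟩ := Real.Angle.angle_eq_iff_two_pi_dvd_sub.1 hc
  have hπ := Real.pi_pos
  have h0 := ccwAngle_nonneg u v; have h1 := ccwAngle_lt_two_pi u v
  have h2 := ccwAngle_nonneg v w; have h3 := ccwAngle_lt_two_pi v w
  have h4 := ccwAngle_nonneg u w; have h5 := ccwAngle_lt_two_pi u w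
  have hk1 : (k : ℝ) < 2 := by
    by_contra hcon; push Not at hcon; nlinarith
  have hk2 : (-1 : ℝ) < k := by
    by_contra hcon; push Not at hcon; nlinarith
  have hk1' : k < 2 := by exact_mod_cast hk1
  have hk2' : -1 < k := by exact_mod_cast hk2
  rcases (show k = 0 ∨ k = 1 by omega) with rfl | rfl
  · left; simp at hk; linarith
  · right; simp at hk; linarith

/-- **Reversal**: if the directions differ, `ccwAngle w u = 2π - ccwAngle u w`.
[cite: Harborth1974, p. 14] -/
theorem ccwAngle_rev {u w : ℂ} (h : ccwAngle u w ≠ 0) : ccwAngle w u = 2 * π - ccwAngle u w := by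
  rcases ccwAngle_add_ccwAngle u w u with h1 | h1
  · rw [ccwAngle_self] at h1
    have := ccwAngle_nonneg w u
    have := ccwAngle_nonneg u w
    exact absurd (by linarith : ccwAngle u w = 0) h
  · rw [ccwAngle_self] at h1; linarith

/-- Positive scaling of the second vector does not change the angle. [cite: Harborth1974, p. 14] -/
theorem ccwAngle_real_mul (u w : ℂ) {r : ℝ} (hr : 0 < r) : ccwAngle u (r * w) = ccwAngle u w := by
  rw [ccwAngle, ccwAngle, arg_real_mul w hr]

/-- **Rotation**: the vector `u · e^{iφ}`, `φ ∈ [0, 2π)`, lies at counter-clockwise angle `φ`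
from `u ≠ 0`. [cite: Harborth1974, p. 14] -/
theorem ccwAngle_mul_exp {u : ℂ} (hu : u ≠ 0) {φ : ℝ} (h0 : 0 ≤ φ) (h1 : φ < 2 * π) :
    ccwAngle u (u * exp (φ * I)) = φ := by
  refine ccwAngle_eq_of_coe_eq h0 h1 ?_
  rw [arg_mul_coe_angle hu (exp_ne_zero _), arg_exp_mul_I, Real.Angle.coe_toIocMod]
  abel

/-- **Polar form**: unit vectors satisfy `w = u · exp (i · ccwAngle u w)`.
[cite: Harborth1974, p. 14] -/
theorem eq_mul_exp_ccwAngle {u w : ℂ} (hu : ‖u‖ = 1) (hw : ‖w‖ = 1) :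
    w = u * exp (ccwAngle u w * I) := by
  have hu' : exp (arg u * I) = u := by
    have := norm_mul_exp_arg_mul_I u; rw [hu] at this; simpa using this
  have hw' : exp (arg w * I) = w := by
    have := norm_mul_exp_arg_mul_I w; rw [hw] at this; simpa using this
  set k := toIcoDiv Real.two_pi_pos 0 (arg w - arg u) with hk
  have hdef : ccwAngle u w = arg w - arg u - k * (2 * π) := by
    have := toIcoMod_add_toIcoDiv_zsmul Real.two_pi_pos 0 (arg w - arg u)
    rw [← hk, zsmul_eq_mul] at this
    rw [ccwAngle]; linarith
  have hexp : (arg u : ℂ) * I + (ccwAngle u w : ℂ) * I =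
      (arg w : ℂ) * I + ((-k : ℤ) : ℂ) * (2 * π * I) := by
    rw [hdef]; push_cast; ring
  symm
  calc u * exp (ccwAngle u w * I) = exp (arg u * I) * exp (ccwAngle u w * I) := by rw [hu']
    _ = exp ((arg w : ℂ) * I + ((-k : ℤ) : ℂ) * (2 * π * I)) := by rw [← Complex.exp_add, hexp]
    _ = w := by rw [Complex.exp_add, exp_int_mul_two_pi_mul_I, mul_one, hw']

/-! ## §2 Unit vectors at distance at least one -/

/-- **Law of cosines for unit vectors**: `‖u - w‖² = 2 - 2 cos (ccwAngle u w)`. [folklore] -/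
private theorem norm_sub_sq_eq {u w : ℂ} (hu : ‖u‖ = 1) (hw : ‖w‖ = 1) :
    ‖u - w‖ ^ 2 = 2 - 2 * Real.cos (ccwAngle u w) := by
  set θ := ccwAngle u w
  have hw' := eq_mul_exp_ccwAngle hu hw
  have h1 : u - w = u * (1 - exp (θ * I)) := by rw [hw']; ring
  rw [h1, norm_mul, hu, one_mul, Complex.sq_norm, Complex.normSq_apply]
  simp only [sub_re, one_re, exp_ofReal_mul_I_re, sub_im, one_im, exp_ofReal_mul_I_im, zero_sub,
    mul_neg, neg_mul, neg_neg]
  nlinarith [Real.sin_sq_add_cos_sq θ]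

/-- **Touching discs subtend at least `π/3`**: two unit vectors at distance `≥ 1` from each other
make a counter-clockwise angle in `[π/3, 5π/3]` (either way round). This is the source of "Jeder
Kreis wird von höchstens sechs anderen berührt". [cite: Harborth1974, p. 14] -/
theorem pi_div_three_le_ccwAngle {u w : ℂ} (hu : ‖u‖ = 1) (hw : ‖w‖ = 1) (h : 1 ≤ ‖u - w‖) :
    π / 3 ≤ ccwAngle u w ∧ ccwAngle u w ≤ 5 * π / 3 := by
  set θ := ccwAngle u w with hθ
  have hcos : Real.cos θ ≤ 1 / 2 := by
    have h2 : 1 ≤ ‖u - w‖ ^ 2 := by nlinarith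
    rw [norm_sub_sq_eq hu hw] at h2
    linarith
  have h0 : 0 ≤ θ := ccwAngle_nonneg u w
  have h2π : θ < 2 * π := ccwAngle_lt_two_pi u w
  have hπ := Real.pi_pos
  constructor
  · by_contra hlt
    push Not at hlt
    have := Real.cos_lt_cos_of_nonneg_of_le_pi h0 (by linarith) hlt
    rw [Real.cos_pi_div_three] at this
    linarith
  · by_contra hlt
    push Not at hlt
    have h3 : Real.cos (π / 3) < Real.cos (2 * π - θ) :=
      Real.cos_lt_cos_of_nonneg_of_le_pi (by linarith) (by linarith) (by linarith)
    rw [Real.cos_pi_div_three, Real.cos_two_pi_sub] at h3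
    linarith

/-! ## §3 Separated points of an interval -/

/-- **Counting separated points.** A finite non-empty set of reals in `[L, U]`, any two of which
differ by at least `δ > 0`, has at most `(U - L)/δ + 1` elements: `(#T - 1) δ ≤ U - L`. [folklore] -/
private theorem card_sub_one_mul_le {T : Finset ℝ} {L U δ : ℝ} (hne : T.Nonempty)
    (hT : ∀ t ∈ T, L ≤ t ∧ t ≤ U) (hsep : ∀ s ∈ T, ∀ t ∈ T, s < t → δ ≤ t - s) :
    ((T.card : ℝ) - 1) * δ ≤ U - L := by
  classical
  -- induct on the maximum, letting the upper bound vary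
  suffices key : ∀ (T : Finset ℝ) (U' : ℝ), T.Nonempty → (∀ t ∈ T, L ≤ t ∧ t ≤ U') →
      (∀ s ∈ T, ∀ t ∈ T, s < t → δ ≤ t - s) → ((T.card : ℝ) - 1) * δ ≤ U' - L from
    key T U hne hT hsep
  intro T
  induction T using Finset.induction_on_max with
  | empty => intro U' h; exact absurd h Finset.not_nonempty_empty
  | insert a s hlt ih =>
    intro U' _ hb hsep
    have has : a ∉ s := fun h => lt_irrefl a (hlt a h)
    rw [Finset.card_insert_of_notMem has]
    push_cast
    rcases s.eq_empty_or_nonempty with rfl | hs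
    · simp only [Finset.card_empty, Nat.cast_zero, zero_add, sub_self, zero_mul, sub_nonneg]
      have := hb a (Finset.mem_insert_self a _); linarith
    · have hb' : ∀ t ∈ s, L ≤ t ∧ t ≤ a - δ := fun t ht =>
        ⟨(hb t (Finset.mem_insert_of_mem ht)).1, by
          have := hsep t (Finset.mem_insert_of_mem ht) a (Finset.mem_insert_self a _) (hlt t ht)
          linarith⟩
      have hsep' : ∀ s' ∈ s, ∀ t ∈ s, s' < t → δ ≤ t - s' := fun s' hs' t ht h =>
        hsep s' (Finset.mem_insert_of_mem hs') t (Finset.mem_insert_of_mem ht) h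
      have := ih (a - δ) hs hb' hsep'
      have ha := hb a (Finset.mem_insert_self a _)
      linarith

/-! ## §4 Neighbours in a hard configuration -/

variable {P : Finset ℂ}

/-- A neighbour is at distance exactly `1`. [cite: Harborth1974, p. 14] -/
theorem norm_sub_eq_one_of_mem_nbrs {p q : ℂ} (hq : q ∈ nbrs P p) : ‖q - p‖ = 1 :=
  (mem_nbrs.1 hq).2

/-- A neighbour differs from the centre. [cite: Harborth1974, p. 14] -/
theorem ne_of_mem_nbrs {p q : ℂ} (hq : q ∈ nbrs P p) : q ≠ p := by
  intro h
  have := norm_sub_eq_one_of_mem_nbrs hq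
  rw [h, sub_self, norm_zero] at this
  exact zero_ne_one this

/-- The bond vector of a neighbour is non-zero. [cite: Harborth1974, p. 14] -/
theorem sub_ne_zero_of_mem_nbrs {p q : ℂ} (hq : q ∈ nbrs P p) : q - p ≠ 0 :=
  sub_ne_zero.2 (ne_of_mem_nbrs hq)

/-- **Two discs touching a third subtend an angle in `[π/3, 5π/3]` at its centre** ("Die
Innenwinkel … nicht kleiner als `(j-1)π/3`" rests on this). [cite: Harborth1974, p. 14] -/
theorem ccwAngle_nbrs (hP : IsHard P) {p q k : ℂ} (hq : q ∈ nbrs P p) (hk : k ∈ nbrs P p)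
    (hne : q ≠ k) : π / 3 ≤ ccwAngle (q - p) (k - p) ∧ ccwAngle (q - p) (k - p) ≤ 5 * π / 3 := by
  refine pi_div_three_le_ccwAngle (norm_sub_eq_one_of_mem_nbrs hq) (norm_sub_eq_one_of_mem_nbrs hk) ?_
  rw [sub_sub_sub_cancel_right, norm_sub_rev]
  exact hP q (mem_nbrs.1 hq).1 k (mem_nbrs.1 hk).1 hne

/-- Distinct neighbours have distinct directions: `ccwAngle = 0` only for `q = k`.
[cite: Harborth1974, p. 14] -/
theorem eq_of_ccwAngle_eq_zero {p q k : ℂ} (hq : q ∈ nbrs P p) (hk : k ∈ nbrs P p)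
    (h : ccwAngle (q - p) (k - p) = 0) : q = k := by
  have harg := ccwAngle_eq_zero_iff.1 h
  have := ext_norm_arg ((norm_sub_eq_one_of_mem_nbrs hq).trans (norm_sub_eq_one_of_mem_nbrs hk).symm) harg
  exact sub_left_injective this

/-- If `ccwAngle (q-p) (k-p) < ccwAngle (q-p) (k'-p)` for neighbours `k, k'` of `p`, then the
difference is the angle from `k` to `k'`, hence at least `π/3`. [cite: Harborth1974, p. 14] -/
theorem ccwAngle_sub_ccwAngle (hP : IsHard P) {p q k k' : ℂ} (hk : k ∈ nbrs P p)
    (hk' : k' ∈ nbrs P p) (hlt : ccwAngle (q - p) (k - p) < ccwAngle (q - p) (k' - p)) :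
    π / 3 ≤ ccwAngle (q - p) (k' - p) - ccwAngle (q - p) (k - p) := by
  have hne : k ≠ k' := by rintro rfl; exact lt_irrefl _ hlt
  rcases ccwAngle_add_ccwAngle (q - p) (k - p) (k' - p) with h | h
  · have := (ccwAngle_nbrs hP hk hk' hne).1; linarith
  · have := ccwAngle_lt_two_pi (k - p) (k' - p)
    have := ccwAngle_nonneg (q - p) (k - p)
    linarith

/-- **Boundary form of "at most six neighbours"** (Harborth's (2) at one vertex). Let `q` be a
neighbour of `p` and suppose every other neighbour `k` of `p` lies at counter-clockwise angle at
least `γ` from `q` (an empty angular gap of size `γ ≤ 2π` following `q`). Then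
`(deg p - 1) · π/3 ≤ 2π - γ`: the `deg p` bond directions lie in the arc `[γ, 2π]` of length
`2π - γ` (the interior angle) together with `q` itself, pairwise `≥ π/3` apart.
[cite: Harborth1974, (2)] -/
theorem card_nbrs_sub_one_mul_le_of_gap (hP : IsHard P) {p q : ℂ} (hq : q ∈ nbrs P p) {γ : ℝ}
    (hγ : γ ≤ 2 * π) (hgap : ∀ k ∈ nbrs P p, k ≠ q → γ ≤ ccwAngle (q - p) (k - p)) :
    (((nbrs P p).card : ℝ) - 1) * (π / 3) ≤ 2 * π - γ := by
  classical
  have hπ := Real.pi_pos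
  set T := ((nbrs P p).erase q).image fun k => ccwAngle (q - p) (k - p) with hT
  have hinj : Set.InjOn (fun k => ccwAngle (q - p) (k - p)) ((nbrs P p).erase q) := by
    intro k hk k' hk' h
    have hk1 := (Finset.mem_erase.1 hk).2
    have hk'1 := (Finset.mem_erase.1 hk').2
    by_contra hne
    rcases lt_or_gt_of_ne (fun h' : ccwAngle (q - p) (k - p) = ccwAngle (q - p) (k' - p) =>
      hne (by
        -- equal angles from `q` force equal directions
        rcases ccwAngle_add_ccwAngle (q - p) (k - p) (k' - p) with h1 | h1
        · exact eq_of_ccwAngle_eq_zero hk1 hk'1 (by linarith)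
        · have := ccwAngle_lt_two_pi (k - p) (k' - p); linarith)) with h1 | h1
    · exact absurd h (ne_of_lt h1)
    · exact absurd h (ne_of_gt h1)
  have hcard : T.card = (nbrs P p).card - 1 := by
    rw [hT, Finset.card_image_of_injOn hinj, Finset.card_erase_of_mem hq]
  rcases ((nbrs P p).erase q).eq_empty_or_nonempty with he | hne
  · have : (nbrs P p).card = 1 := by
      have := Finset.card_erase_of_mem hq; rw [he, Finset.card_empty] at this
      have := hq; have hpos := Finset.card_pos.2 ⟨q, hq⟩; omega
    rw [this]; simp; linarith
  have hTne : T.Nonempty := hne.image _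
  have hbounds : ∀ t ∈ T, γ ≤ t ∧ t ≤ 5 * π / 3 := by
    intro t ht
    obtain ⟨k, hk, rfl⟩ := Finset.mem_image.1 ht
    obtain ⟨hkq, hk⟩ := Finset.mem_erase.1 hk
    exact ⟨hgap k hk hkq, (ccwAngle_nbrs hP hq hk (Ne.symm hkq)).2⟩
  have hsep : ∀ s ∈ T, ∀ t ∈ T, s < t → π / 3 ≤ t - s := by
    intro s hs t ht hst
    obtain ⟨k, hk, rfl⟩ := Finset.mem_image.1 hs
    obtain ⟨k', hk', rfl⟩ := Finset.mem_image.1 ht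
    exact ccwAngle_sub_ccwAngle hP (q := q) (Finset.mem_erase.1 hk).2 (Finset.mem_erase.1 hk').2 hst
  have key := card_sub_one_mul_le hTne hbounds hsep
  rw [hcard] at key
  have h1 : 1 ≤ (nbrs P p).card := Finset.card_pos.2 ⟨q, hq⟩
  rw [Nat.cast_sub h1] at key
  push_cast at key
  linarith

/-- **"Jeder Kreis wird von höchstens sechs anderen berührt"**: in a hard configuration every disc
touches at most six others (Harborth p. 14; Heitmann–Radin p. 282 "each sphere … can touch at most
six others"). [cite: Harborth1974, p. 14] -/
theorem card_nbrs_le_six (hP : IsHard P) (p : ℂ) : (nbrs P p).card ≤ 6 := by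
  classical
  rcases (nbrs P p).eq_empty_or_nonempty with he | ⟨q, hq⟩
  · rw [he]; simp
  have hπ := Real.pi_pos
  have key := card_nbrs_sub_one_mul_le_of_gap hP hq (γ := π / 3) (by linarith)
    (fun k hk hkq => (ccwAngle_nbrs hP hq hk (Ne.symm hkq)).1)
  have : ((nbrs P p).card : ℝ) ≤ 6 := by nlinarith
  exact_mod_cast this

end Harborth

end Literature.Geometry.DiscreteGeometry

end
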